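import Summits.QuantumFields.YangMills.Theorems.ContinuumLimitOnTrajectory.Negative.WitnessRigidity

/-!
# `ContinuumLimitOnTrajectory` — negative-side support IX: the truncated three-point function
# (`c³`-scaling, `m`-invisibility, renormalisation-free skewness)

Support file for crux `stmt-QuantumFields-10522` ((A) of `ParabolicTrajectory`), extracted from §8 of the
standing disprover's work file `Cruxes/ContinuumLimitOnTrajectory/Disproof.lean` (cdisprove gen 3).

* `cum3`, `integral_affine₁₂₃`, `cum3_affine`: affine field redefinitions act on the third cumulant by `c³`.
* `threePointKernel`, `latticeSchwinger_three`, `latticeSchwinger_conn_three_eq`: the truncated lattice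
  three-point function of the renormalised curvature field is `c_k³` times the unit-normalised kernel.
* `Tn`, `Tn_apply`, `isTensorOf_Tn`, `isOffDiagonal_Tn` (pairwise disjointly supported real tensors of any arity
  are in `⁰𝒮`), `T3`, `S3T`, `PairwiseDisjoint3`.
* `tendsto_c_cube_mul_kernel3` (`c_k³ K3_k → 𝔖₃ᵀ` under `IsYangMillsFor`), `tendsto_skewness_ratio`: the
  normalised lattice skewness `K3_k(f,g,h)²/K_k(u₀,v₀)³` converges — the sign ambiguity of `c_k` is removed by
  squaring. A Gaussian (trivial) scaling limit of `tr F²` would kill the `IsNonGaussian` clause of (A).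
-/

namespace Summit.QuantumFields.YangMills.Theorems.ContinuumLimitOnTrajectory.Negative

open MeasureTheory Filter Topology Complex
open scoped SchwartzMap ComplexConjugate
open Literature.MathematicalPhysics.QuantumFieldTheory Literature.MathematicalPhysics.QuantumLattice
open Literature.MathematicalPhysics.AQFT (IsOffDiagonal coincidenceLocus)
open Literature.Probability.LatticeModels (box)

noncomputable section

section Cumulant3

variable {Ω : Type*} [MeasurableSpace Ω] (μ : Measure Ω) [IsProbabilityMeasure μ]

/-- The third cumulant (connected three-point function) of real random variables. [folklore] -/
def cum3 (X Y Z : Ω → ℝ) : ℝ :=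
  (∫ ω, X ω * Y ω * Z ω ∂μ) - (∫ ω, X ω ∂μ) * (∫ ω, Y ω * Z ω ∂μ) -
    (∫ ω, Y ω ∂μ) * (∫ ω, X ω * Z ω ∂μ) - (∫ ω, Z ω ∂μ) * (∫ ω, X ω * Y ω ∂μ) +
    2 * ((∫ ω, X ω ∂μ) * (∫ ω, Y ω ∂μ) * (∫ ω, Z ω ∂μ))

/-- Expectation of an affine image. [folklore] -/
theorem integral_affine₁ {X : Ω → ℝ} (hX : Integrable X μ) (c d : ℝ) :
    ∫ ω, (c * X ω + d) ∂μ = c * (∫ ω, X ω ∂μ) + d := by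
  rw [integral_add (hX.const_mul c) (integrable_const d), integral_const_mul, integral_const,
    probReal_univ, one_smul]

/-- Expectation of a product of two affine images. [folklore] -/
theorem integral_affine₂ {X Y : Ω → ℝ} (hX : Integrable X μ) (hY : Integrable Y μ)
    (hXY : Integrable (fun ω => X ω * Y ω) μ) (c d d' : ℝ) :
    ∫ ω, (c * X ω + d) * (c * Y ω + d') ∂μ =
      c ^ 2 * (∫ ω, X ω * Y ω ∂μ) + c * d' * (∫ ω, X ω ∂μ) + c * d * (∫ ω, Y ω ∂μ) + d * d' := by
  have h : ∀ ω, (c * X ω + d) * (c * Y ω + d') =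
      c ^ 2 * (X ω * Y ω) + c * d' * X ω + (c * d * Y ω + d * d') := fun ω => by ring
  simp_rw [h]
  rw [integral_add, integral_add, integral_add]
  · simp only [integral_const_mul, integral_const, probReal_univ, one_smul]
    ring
  all_goals first
    | exact integrable_const _
    | exact hX.const_mul _
    | exact hY.const_mul _
    | exact hXY.const_mul _
    | exact (hXY.const_mul _).add (hX.const_mul _)
    | exact (hY.const_mul _).add (integrable_const _)

/-- Expectation of a product of three affine images. [folklore] -/
theorem integral_affine₃ {X Y Z : Ω → ℝ} (hX : Integrable X μ) (hY : Integrable Y μ)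
    (hZ : Integrable Z μ) (hXY : Integrable (fun ω => X ω * Y ω) μ)
    (hXZ : Integrable (fun ω => X ω * Z ω) μ) (hYZ : Integrable (fun ω => Y ω * Z ω) μ)
    (hXYZ : Integrable (fun ω => X ω * Y ω * Z ω) μ) (c d d' d'' : ℝ) :
    ∫ ω, (c * X ω + d) * (c * Y ω + d') * (c * Z ω + d'') ∂μ =
      c ^ 3 * (∫ ω, X ω * Y ω * Z ω ∂μ) + c ^ 2 * d'' * (∫ ω, X ω * Y ω ∂μ) +
        c ^ 2 * d' * (∫ ω, X ω * Z ω ∂μ) + c ^ 2 * d * (∫ ω, Y ω * Z ω ∂μ) +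
        c * d' * d'' * (∫ ω, X ω ∂μ) + c * d * d'' * (∫ ω, Y ω ∂μ) + c * d * d' * (∫ ω, Z ω ∂μ) +
        d * d' * d'' := by
  have h : ∀ ω, (c * X ω + d) * (c * Y ω + d') * (c * Z ω + d'') =
      (c ^ 3 * (X ω * Y ω * Z ω) + c ^ 2 * d'' * (X ω * Y ω)) +
      (c ^ 2 * d' * (X ω * Z ω) + c ^ 2 * d * (Y ω * Z ω)) +
      ((c * d' * d'' * X ω + c * d * d'' * Y ω) + (c * d * d' * Z ω + d * d' * d'')) := fun ω => by
    ring
  simp_rw [h]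
  rw [integral_add, integral_add, integral_add, integral_add, integral_add, integral_add,
    integral_add]
  · simp only [integral_const_mul, integral_const, probReal_univ, one_smul]
    ring
  all_goals first
    | exact integrable_const _
    | exact hX.const_mul _
    | exact hY.const_mul _
    | exact hZ.const_mul _
    | exact hXY.const_mul _
    | exact hXZ.const_mul _
    | exact hYZ.const_mul _
    | exact hXYZ.const_mul _
    | exact (hXYZ.const_mul _).add (hXY.const_mul _)
    | exact (hXZ.const_mul _).add (hYZ.const_mul _)
    | exact (hX.const_mul _).add (hY.const_mul _)
    | exact (hZ.const_mul _).add (integrable_const _)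
    | exact ((hXYZ.const_mul _).add (hXY.const_mul _)).add ((hXZ.const_mul _).add (hYZ.const_mul _))
    | exact ((hX.const_mul _).add (hY.const_mul _)).add ((hZ.const_mul _).add (integrable_const _))

/-- **Affine maps act on the third cumulant by `c³`; the shifts drop out.** [folklore] -/
theorem cum3_affine {X Y Z : Ω → ℝ} (hX : Integrable X μ) (hY : Integrable Y μ)
    (hZ : Integrable Z μ) (hXY : Integrable (fun ω => X ω * Y ω) μ)
    (hXZ : Integrable (fun ω => X ω * Z ω) μ) (hYZ : Integrable (fun ω => Y ω * Z ω) μ)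
    (hXYZ : Integrable (fun ω => X ω * Y ω * Z ω) μ) (c d d' d'' : ℝ) :
    cum3 μ (fun ω => c * X ω + d) (fun ω => c * Y ω + d') (fun ω => c * Z ω + d'') =
      c ^ 3 * cum3 μ X Y Z := by
  unfold cum3
  rw [integral_affine₃ μ hX hY hZ hXY hXZ hYZ hXYZ, integral_affine₂ μ hY hZ hYZ,
    integral_affine₂ μ hX hZ hXZ, integral_affine₂ μ hX hY hXY, integral_affine₁ μ hX,
    integral_affine₁ μ hY, integral_affine₁ μ hZ]
  ring

/-- The same with subtractive shifts. [folklore] -/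
theorem cum3_affine_sub {X Y Z : Ω → ℝ} (hX : Integrable X μ) (hY : Integrable Y μ)
    (hZ : Integrable Z μ) (hXY : Integrable (fun ω => X ω * Y ω) μ)
    (hXZ : Integrable (fun ω => X ω * Z ω) μ) (hYZ : Integrable (fun ω => Y ω * Z ω) μ)
    (hXYZ : Integrable (fun ω => X ω * Y ω * Z ω) μ) (c e e' e'' : ℝ) :
    cum3 μ (fun ω => c * X ω - e) (fun ω => c * Y ω - e') (fun ω => c * Z ω - e'') =
      c ^ 3 * cum3 μ X Y Z := by
  simp only [sub_eq_add_neg]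
  exact cum3_affine μ hX hY hZ hXY hXZ hYZ hXYZ c (-e) (-e') (-e'')

end Cumulant3

section ThreePoint

variable {G : Type} [Group G] [TopologicalSpace G] [IsTopologicalGroup G] [CompactSpace G]
  [MeasurableSpace G] [BorelSpace G] {N : ℕ}

/-- **The unit-normalised connected THREE-point kernel** of the lattice curvature field (third cumulant
of `Φ_{1,0}(f), Φ_{1,0}(g), Φ_{1,0}(h)` under Wilson's measure): bare data only. [folklore] -/
def threePointKernel (ρ : G →* Matrix (Fin N) (Fin N) ℂ) (a β : ℝ) (L : ℕ) (f g h : 𝓢((EuclideanSpace ℝ (Fin 4)), ℝ)) : ℝ :=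
  cum3 (wilsonMeasure (d := 4) (L := 2 * L + 1) ρ β) (unitField ρ a L f) (unitField ρ a L g)
    (unitField ρ a L h)

/-- The lattice three-point function of the curvature species on three real test functions. [folklore] -/
theorem latticeSchwinger_three (r : LatticeRep G) (sch : SpeciesScheme (YMSpecies G)) (k : ℕ)
    (f g h : 𝓢((EuclideanSpace ℝ (Fin 4)), ℝ)) :
    latticeSchwinger r.ρ sch (fun s => s.F) k 3 (fun _ => r.curvature) ![f, g, h] =
      ∫ U, smearedLatticeField (actionDensity r.ρ) (box 4 (sch.L k)) (sch.a k)
          (sch.c r.curvature k) (sch.m r.curvature k) f (torusLift (sch.side k) U) *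
        smearedLatticeField (actionDensity r.ρ) (box 4 (sch.L k)) (sch.a k)
          (sch.c r.curvature k) (sch.m r.curvature k) g (torusLift (sch.side k) U) *
        smearedLatticeField (actionDensity r.ρ) (box 4 (sch.L k)) (sch.a k)
          (sch.c r.curvature k) (sch.m r.curvature k) h (torusLift (sch.side k) U)
        ∂(wilsonMeasure (d := 4) (L := sch.side k) r.ρ (sch.β k)) := by
  unfold latticeSchwinger
  simp only [Fin.prod_univ_succ, Fin.prod_univ_zero, mul_one, Matrix.cons_val_zero,
    Matrix.cons_val_succ, curvature_F, mul_assoc]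

/-- **`c³`-scaling and `m`-invisibility of the truncated lattice three-point function.** [folklore] -/
theorem latticeSchwinger_conn_three_eq (r : LatticeRep G) (sch : SpeciesScheme (YMSpecies G)) (k : ℕ)
    (f g h : 𝓢((EuclideanSpace ℝ (Fin 4)), ℝ)) :
    let L : (n : ℕ) → (Fin n → 𝓢((EuclideanSpace ℝ (Fin 4)), ℝ)) → ℝ :=
      fun n φ => latticeSchwinger r.ρ sch (fun s => s.F) k n (fun _ => r.curvature) φ
    L 3 ![f, g, h] - L 1 ![f] * L (1 + 1) ![g, h] - L 1 ![g] * L (1 + 1) ![f, h] -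
        L 1 ![h] * L (1 + 1) ![f, g] + 2 * (L 1 ![f] * L 1 ![g] * L 1 ![h]) =
      (sch.c r.curvature k) ^ 3 * threePointKernel r.ρ (sch.a k) (sch.β k) (sch.L k) f g h := by
  intro L
  haveI := isProbabilityMeasure_wilsonMeasure (d := 4) (L := sch.side k) r.ρ r.continuous (sch.β k)
  simp only [L, latticeSchwinger_three, latticeSchwinger_two, latticeSchwinger_one]
  set e : 𝓢((EuclideanSpace ℝ (Fin 4)), ℝ) → ℝ := fun f => sch.c r.curvature k * sch.m r.curvature k * sch.a k ^ 4 *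
      ∑ x ∈ box 4 (sch.L k), f (sch.a k • siteToE x) with he
  have hΦ : ∀ (φ : 𝓢((EuclideanSpace ℝ (Fin 4)), ℝ)) (U : GaugeConfig 4 (sch.side k) G),
      smearedLatticeField (actionDensity r.ρ) (box 4 (sch.L k)) (sch.a k) (sch.c r.curvature k)
        (sch.m r.curvature k) φ (torusLift (sch.side k) U) =
      sch.c r.curvature k * unitField r.ρ (sch.a k) (sch.L k) φ U - e φ := fun φ U => by
    rw [smearedLatticeField_affine]; rfl
  simp_rw [hΦ]
  have hf := continuous_unitField (ρ := r.ρ) r.continuous (sch.a k) (sch.L k) f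
  have hg := continuous_unitField (ρ := r.ρ) r.continuous (sch.a k) (sch.L k) g
  have hh := continuous_unitField (ρ := r.ρ) r.continuous (sch.a k) (sch.L k) h
  exact cum3_affine_sub (wilsonMeasure (d := 4) (L := sch.side k) r.ρ (sch.β k))
    (X := unitField r.ρ (sch.a k) (sch.L k) f) (Y := unitField r.ρ (sch.a k) (sch.L k) g)
    (Z := unitField r.ρ (sch.a k) (sch.L k) h)
    (integrable_wilson r _ hf) (integrable_wilson r _ hg) (integrable_wilson r _ hh)
    (integrable_wilson r _ (hf.mul hg)) (integrable_wilson r _ (hf.mul hh))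
    (integrable_wilson r _ (hg.mul hh)) (integrable_wilson r _ ((hf.mul hg).mul hh))
    (sch.c r.curvature k) (e f) (e g) (e h)

end ThreePoint

section Skewness

open Literature.MathematicalPhysics.AQFT (IsOffDiagonal coincidenceLocus)

variable {ι : Type}

/-- Real product tensors of any arity, complexified. [folklore] -/
def Tn {n : ℕ} (f : Fin n → 𝓢((EuclideanSpace ℝ (Fin 4)), ℝ)) : 𝓢((Fin n → (EuclideanSpace ℝ (Fin 4))), ℂ) :=
  SchwartzMap.tensorFin n fun i => ofRealTest (f i)

/-- `Tn f x = ∏ᵢ fᵢ(xᵢ)`. [folklore] -/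
theorem Tn_apply {n : ℕ} (f : Fin n → 𝓢((EuclideanSpace ℝ (Fin 4)), ℝ)) (x : Fin n → (EuclideanSpace ℝ (Fin 4))) : Tn f x = ∏ i, ((f i (x i) : ℝ) : ℂ) := by
  simp [Tn, SchwartzMap.tensorFin_apply]

/-- `Tn f` is a tensor of the complexified `fᵢ`. [folklore] -/
theorem isTensorOf_Tn {n : ℕ} (f : Fin n → 𝓢((EuclideanSpace ℝ (Fin 4)), ℝ)) : IsTensorOf (Tn f) fun i => ofRealTest (f i) :=
  isTensorOf_tensorFin _

/-- **Pairwise disjointly supported real tensors are off-diagonal** (any arity). [folklore] -/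
theorem isOffDiagonal_Tn {n : ℕ} (f : Fin n → 𝓢((EuclideanSpace ℝ (Fin 4)), ℝ))
    (h : Pairwise fun i j => Disjoint (tsupport (f i : (EuclideanSpace ℝ (Fin 4)) → ℝ)) (tsupport (f j : (EuclideanSpace ℝ (Fin 4)) → ℝ))) :
    IsOffDiagonal (Tn f) := by
  apply IsOffDiagonal.of_tsupport_subset
  have hC : IsClosed {x : Fin n → (EuclideanSpace ℝ (Fin 4)) | ∀ i, x i ∈ tsupport (f i : (EuclideanSpace ℝ (Fin 4)) → ℝ)} := by
    have : {x : Fin n → (EuclideanSpace ℝ (Fin 4)) | ∀ i, x i ∈ tsupport (f i : (EuclideanSpace ℝ (Fin 4)) → ℝ)} =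
        ⋂ i, (fun x : Fin n → (EuclideanSpace ℝ (Fin 4)) => x i) ⁻¹' tsupport (f i : (EuclideanSpace ℝ (Fin 4)) → ℝ) := by
      ext x; simp
    rw [this]
    exact isClosed_iInter fun i => (isClosed_tsupport _).preimage (continuous_apply i)
  have hsupp : Function.support (Tn f : (Fin n → (EuclideanSpace ℝ (Fin 4))) → ℂ) ⊆
      {x | ∀ i, x i ∈ tsupport (f i : (EuclideanSpace ℝ (Fin 4)) → ℝ)} := by
    intro x hx i
    rw [Function.mem_support, Tn_apply] at hx
    have hi := (Finset.prod_ne_zero_iff.1 hx) i (Finset.mem_univ _)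
    exact subset_closure (Function.mem_support.2 fun h0 => hi (by simp [h0]))
  refine (closure_minimal hsupp hC).trans ?_
  rintro x hx ⟨i, j, hij, hxij⟩
  have h1 : x i ∈ tsupport (f i : (EuclideanSpace ℝ (Fin 4)) → ℝ) := hx i
  have h2 : x i ∈ tsupport (f j : (EuclideanSpace ℝ (Fin 4)) → ℝ) := hxij ▸ hx j
  exact Set.disjoint_left.1 (h hij) h1 h2

/-- `T1` is the arity-one case of `Tn`. [folklore] -/
theorem T1_eq_Tn (u : 𝓢((EuclideanSpace ℝ (Fin 4)), ℝ)) : T1 u = Tn ![u] := rfl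
/-- `T2` is the arity-two case of `Tn`. [folklore] -/
theorem T2_eq_Tn (u v : 𝓢((EuclideanSpace ℝ (Fin 4)), ℝ)) : T2 u v = Tn ![u, v] := rfl

/-- The three-variable real product tensor. [folklore] -/
abbrev T3 (f g h : 𝓢((EuclideanSpace ℝ (Fin 4)), ℝ)) : 𝓢((Fin 3 → (EuclideanSpace ℝ (Fin 4))), ℂ) := Tn ![f, g, h]

/-- The truncated (connected) continuum THREE-point function of the species `s` on `f ⊗ g ⊗ h`. [folklore] -/
def S3T (T : OSData ι 4) (s : ι) (f g h : 𝓢((EuclideanSpace ℝ (Fin 4)), ℝ)) : ℂ :=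
  T.schwinger 3 (fun _ => s) (T3 f g h) -
    T.schwinger 1 (fun _ => s) (T1 f) * T.schwinger (1 + 1) (fun _ => s) (T2 g h) -
    T.schwinger 1 (fun _ => s) (T1 g) * T.schwinger (1 + 1) (fun _ => s) (T2 f h) -
    T.schwinger 1 (fun _ => s) (T1 h) * T.schwinger (1 + 1) (fun _ => s) (T2 f g) +
    2 * (T.schwinger 1 (fun _ => s) (T1 f) * T.schwinger 1 (fun _ => s) (T1 g) *
      T.schwinger 1 (fun _ => s) (T1 h))

/-- Pairwise disjoint supports of three real test functions. [folklore] -/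
def PairwiseDisjoint3 (f g h : 𝓢((EuclideanSpace ℝ (Fin 4)), ℝ)) : Prop :=
  Disjoint (tsupport (f : (EuclideanSpace ℝ (Fin 4)) → ℝ)) (tsupport (g : (EuclideanSpace ℝ (Fin 4)) → ℝ)) ∧
    Disjoint (tsupport (f : (EuclideanSpace ℝ (Fin 4)) → ℝ)) (tsupport (h : (EuclideanSpace ℝ (Fin 4)) → ℝ)) ∧
    Disjoint (tsupport (g : (EuclideanSpace ℝ (Fin 4)) → ℝ)) (tsupport (h : (EuclideanSpace ℝ (Fin 4)) → ℝ))

/-- Disjoint supports, as a `Pairwise` statement over `Fin 2`. [folklore] -/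
theorem pairwise_two {u v : 𝓢((EuclideanSpace ℝ (Fin 4)), ℝ)} (huv : Disjoint (tsupport (u : (EuclideanSpace ℝ (Fin 4)) → ℝ)) (tsupport (v : (EuclideanSpace ℝ (Fin 4)) → ℝ))) :
    Pairwise fun i j => Disjoint (tsupport (![u, v] i : (EuclideanSpace ℝ (Fin 4)) → ℝ)) (tsupport (![u, v] j : (EuclideanSpace ℝ (Fin 4)) → ℝ)) := by
  intro i j hij
  fin_cases i <;> fin_cases j <;> simp_all [huv.symm]

/-- Pairwise disjoint supports, as a `Pairwise` statement over `Fin 3`. [folklore] -/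
theorem pairwise_three {f g h : 𝓢((EuclideanSpace ℝ (Fin 4)), ℝ)} (hp : PairwiseDisjoint3 f g h) :
    Pairwise fun i j => Disjoint (tsupport (![f, g, h] i : (EuclideanSpace ℝ (Fin 4)) → ℝ)) (tsupport (![f, g, h] j : (EuclideanSpace ℝ (Fin 4)) → ℝ)) := by
  obtain ⟨hfg, hfh, hgh⟩ := hp
  intro i j hij
  fin_cases i <;> fin_cases j <;> simp_all [hfg.symm, hfh.symm, hgh.symm]

variable {G : Type} [Group G] [TopologicalSpace G] [IsTopologicalGroup G] [CompactSpace G]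
  [MeasurableSpace G] [BorelSpace G]

/-- **The witness's truncated three-point function is the limit of `c_k³ K3_k`** (pairwise disjointly
supported real triples). [folklore] -/
theorem tendsto_c_cube_mul_kernel3 (r : LatticeRep G) (sch : SpeciesScheme (YMSpecies G))
    (T : OSData (YMSpecies G) 4) (hT : IsYangMillsFor r sch T) {f g h : 𝓢((EuclideanSpace ℝ (Fin 4)), ℝ)}
    (hp : PairwiseDisjoint3 f g h) :
    Tendsto (fun k => (((sch.c r.curvature k) ^ 3 *
        threePointKernel r.ρ (sch.a k) (sch.β k) (sch.L k) f g h : ℝ) : ℂ)) atTop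
      (𝓝 (S3T T r.curvature f g h)) := by
  obtain ⟨hfg, hfh, hgh⟩ := id hp
  have h3 := hT 3 (by norm_num) (fun _ => r.curvature) ![f, g, h] (T3 f g h) (isTensorOf_Tn _)
    (isOffDiagonal_Tn _ (pairwise_three hp))
  have hf := hT 1 one_ne_zero (fun _ => r.curvature) ![f] (T1 f) (isTensorOf_T1 f) (isOffDiagonal_one _)
  have hg := hT 1 one_ne_zero (fun _ => r.curvature) ![g] (T1 g) (isTensorOf_T1 g) (isOffDiagonal_one _)
  have hh := hT 1 one_ne_zero (fun _ => r.curvature) ![h] (T1 h) (isTensorOf_T1 h) (isOffDiagonal_one _)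
  have hgh2 := hT (1 + 1) (by norm_num) (fun _ => r.curvature) ![g, h] (T2 g h) (isTensorOf_T2 g h)
    (by rw [T2_eq_Tn]; exact isOffDiagonal_Tn _ (pairwise_two hgh))
  have hfh2 := hT (1 + 1) (by norm_num) (fun _ => r.curvature) ![f, h] (T2 f h) (isTensorOf_T2 f h)
    (by rw [T2_eq_Tn]; exact isOffDiagonal_Tn _ (pairwise_two hfh))
  have hfg2 := hT (1 + 1) (by norm_num) (fun _ => r.curvature) ![f, g] (T2 f g) (isTensorOf_T2 f g)
    (by rw [T2_eq_Tn]; exact isOffDiagonal_Tn _ (pairwise_two hfg))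
  have hlim := (((h3.sub (hf.mul hgh2)).sub (hg.mul hfh2)).sub (hh.mul hfg2)).add
    ((hf.mul hg).mul hh |>.const_mul (2 : ℂ))
  refine hlim.congr' (Eventually.of_forall fun k => ?_)
  have e := latticeSchwinger_conn_three_eq r sch k f g h
  simp only at e
  push_cast [← e]
  ring

/-- **Renormalisation-free skewness.** If `𝔖₂ᵀ(u₀ ⊗ v₀) ≠ 0`, the normalised lattice skewness
`K3_k(f,g,h)² / K_k(u₀,v₀)³` converges (to `𝔖₃ᵀ(f⊗g⊗h)² / 𝔖₂ᵀ(u₀⊗v₀)³`) — the sign ambiguity of `c_k`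
is removed by squaring. [folklore] -/
theorem tendsto_skewness_ratio (r : LatticeRep G) (sch : SpeciesScheme (YMSpecies G))
    (T : OSData (YMSpecies G) 4) (hT : IsYangMillsFor r sch T) {u₀ v₀ f g h : 𝓢((EuclideanSpace ℝ (Fin 4)), ℝ)}
    (h₀ : IsOffDiagonal (T2 u₀ v₀)) (hne : S2T T r.curvature u₀ v₀ ≠ 0)
    (hp : PairwiseDisjoint3 f g h) :
    Tendsto (fun k => (((threePointKernel r.ρ (sch.a k) (sch.β k) (sch.L k) f g h) ^ 2 /
        (twoPointKernel r.ρ (sch.a k) (sch.β k) (sch.L k) u₀ v₀) ^ 3 : ℝ) : ℂ)) atTop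
      (𝓝 ((S3T T r.curvature f g h) ^ 2 / (S2T T r.curvature u₀ v₀) ^ 3)) := by
  have hA := (tendsto_c_cube_mul_kernel3 r sch T hT hp).pow 2
  have hB := (tendsto_c_sq_mul_kernel r sch T hT h₀).pow 3
  refine (hA.div hB (pow_ne_zero 3 hne)).congr' ?_
  filter_upwards [eventually_c_ne_zero_and_kernel_ne_zero r sch T hT h₀ hne] with k hk
  have hc : (sch.c r.curvature k : ℂ) ≠ 0 := ofReal_ne_zero.2 hk.1
  have hK : (twoPointKernel r.ρ (sch.a k) (sch.β k) (sch.L k) u₀ v₀ : ℂ) ≠ 0 := ofReal_ne_zero.2 hk.2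
  simp only [Pi.div_apply]
  push_cast
  field_simp

end Skewness

end

end Summit.QuantumFields.YangMills.Theorems.ContinuumLimitOnTrajectory.Negative
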